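import Literature.Probability.LatticeModels.SixVertexSpectralFRotation
import Literature.Probability.LatticeModels.SixVertexSpectralTiltMeasure
import Literature.Analysis.Fourier.CharFunHalfPlaneSupport

/-!
# Six-vertex spectral measures: concentration on `{|b| ≤ a}` (DKLM 2026, Part II, Theorem 40)

H. Duminil-Copin, K. K. Kozlowski, P. Lammers, I. Manolescu, *Gaussian free field convergence of
the six-vertex model with `-1 ≤ Δ ≤ -1/2`*, arXiv:2603.06268 (2026) [DKLM2026SixVertexGFF]
(`paper:arxiv-2603.06268`, chunks p0027–p0029):

> **Theorem 40.** For every convergence sub-sequence `(δ_n)_n`, we have `μ[{|b| > a}] = 0`.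
>
> *Proof.* Since `ae^{-a}` is a strictly positive function on `ℝ_{>0}`, it suffices to prove that,
> for any `λ > 1`, we have `F(1,0) = ∫ ae^{-a} dμ(a,b) = ∫ 𝟙{|b| ≤ λa} ae^{-a} dμ(a,b)`. […]
> `2i ∫ sin(λat) ae^{-a-ibt} dμ(a,b) = F(1-iλt,t) - F(1+iλt,t) =: F_-(t) - F_+(t)` […]
> Equation (eq:rotation_of_F) implies that
> `F_±(t) = (1 ± iλt)/√((1 ± iλt)² + t²) · F(√((1 ± iλt)² + t²), 0)`. […]
> **Claim.** (i) The set `𝒩_-` contains `ℍ⁺ := {z ∈ ℂ : Im(z) > 0}`, (ii) the function `|F_-|` is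
> uniformly bounded on `ℍ⁺` […]. *Proof of the Claim.* Introduce `α(t) = (1 - iλt)² + t²` […]
> `Re(√t) ≥ 1` if and only if `t` is on or to the right of the parabolic curve `{(1+it)² : t ∈ ℝ}`
> […] `α(x+iy) = 1 + 2λy + (λ²-1)(y²-x²) - 2ix(λ + (λ²-1)y)` […] We conclude that
> `Re(√α(t)) ≥ 1` for any `t ∈ ℍ⁺`. […] `|F(√α(t),0)| ≤ F(Re(√α(t)),0) ≤ F(1,0)`. This yields
> Property (ii) since the factor `(1-iλt)/√α(t)` is also bounded on `ℍ⁺`.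

This file proves **Theorem 40 for a measure `μ ∈ 𝓜_{c,C}` conditionally on the rotation
formula** of Lemma 43 in its real-axis form `F(x,y) = x/√(x²+y²) F(√(x²+y²),0)`, `x > 0` (which is
eq. (F_as_derivative_of_I) of Lemma 38 (iii), the consequence of the rotational invariance
Theorem 4; `SixVertexSpectralFRotation.lean` extends it to `x ∈ ℂ₊`).

The contour-integral argument of the printed proof (Lemma 44, the paths `γ_ε^±`, the residue at
`t = 0` and the final shift to `ℝ + iσ/2`) is replaced by the classical fact it re-proves: the
function `F_-(t) = F(1-iλt, t) = ∫ a e^{-a} e^{i(λa-b)t} dμ` is the characteristic function of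
the finite measure `ρ_λ = (a e^{-a} μ) ∘ (λa-b)⁻¹` (`charFun_map_linear_tiltMeasure`), and by the
Claim it is the boundary value of the bounded holomorphic function
`Φ_λ(t) = (1-iλt)/√α(t) · F(√α(t), 0)` on `ℍ⁺`; hence `ρ_λ((-∞,0)) = 0`
(`Literature.Analysis.Fourier.measure_Iio_eq_zero_of_charFun_eq_of_continuousAt`, the one-sided
Paley–Wiener theorem for measures), i.e. `μ{b > λa} = 0`; by the reflection symmetry of `μ` and
`λ ↓ 1` the theorem follows.

* `dklmAlpha` (`α_λ(t) = (1-iλt)² + t²`), `dklmAlpha_re/im` (eq. (explicit_alpha)),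
  `one_le_csqrt_re_of_parabola` (the parabola criterion for `Re √w ≥ 1`),
  **`one_le_re_csqrt_dklmAlpha`** (Claim (i)), `norm_div_csqrt_dklmAlpha_le` (the factor is
  bounded by `λ/(λ-1)`), `dklmPhiMinus` (`Φ_λ`), `norm_dklmPhiMinus_le` (Claim (ii)),
  `differentiableAt_dklmPhiMinus`, `dklmPhiMinus_ofReal` (`Φ_λ = F_-` on `ℝ`, Lemma 43);
* `measure_gt_mul_eq_zero` (`μ{0 < a, λa < b} = 0`), `measure_gt_mul_neg_eq_zero` (reflection),
  **`dklm_upperBoundOnB`** — Theorem 40: `μ{a < |b|} = 0`.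

## References

* H. Duminil-Copin, K. K. Kozlowski, P. Lammers, I. Manolescu, arXiv:2603.06268 (2026), Part II,
  Theorem 40 and its proof (Claim (i)–(ii)), Lemma 43. [DKLM2026SixVertexGFF]
-/

noncomputable section

open MeasureTheory Set Filter Topology Complex
open scoped ENNReal
open Literature.Analysis.Fourier

namespace Literature.Probability.LatticeModels.SixVertex

/-! ## 1. The function `α_λ(t) = (1 - iλt)² + t²` and the parabola criterion -/

/-- `α_λ(t) := (1 - iλt)² + t²`. [cite: DKLM2026SixVertexGFF, Part II, proof of Theorem 40 (proof of the Claim)] -/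
def dklmAlpha (lam : ℝ) (t : ℂ) : ℂ := (1 - I * lam * t) ^ 2 + t ^ 2

/-- **eq. (explicit_alpha), real part**: `Re α(x+iy) = 1 + 2λy + (λ²-1)(y²-x²)`.
[cite: DKLM2026SixVertexGFF, Part II, proof of Theorem 40, eq. (explicit_alpha)] -/
theorem dklmAlpha_re (lam : ℝ) (t : ℂ) :
    (dklmAlpha lam t).re = 1 + 2 * lam * t.im + (lam ^ 2 - 1) * (t.im ^ 2 - t.re ^ 2) := by
  simp only [dklmAlpha, sq, add_re, mul_re, sub_re, one_re, I_re, ofReal_re, I_im, ofReal_im, mul_im, sub_im,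
    one_im]
  ring

/-- **eq. (explicit_alpha), imaginary part**: `Im α(x+iy) = -2x(λ + (λ²-1)y)`.
[cite: DKLM2026SixVertexGFF, Part II, proof of Theorem 40, eq. (explicit_alpha)] -/
theorem dklmAlpha_im (lam : ℝ) (t : ℂ) :
    (dklmAlpha lam t).im = -2 * t.re * (lam + (lam ^ 2 - 1) * t.im) := by
  simp only [dklmAlpha, sq, add_im, mul_re, sub_re, one_re, I_re, ofReal_re, I_im, ofReal_im, mul_im, sub_im,
    one_im]
  ring

/-- `α_λ(t) = (1 - i(λ+1)t)(1 - i(λ-1)t)`. [cite: DKLM2026SixVertexGFF, Part II, proof of Theorem 40] -/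
theorem dklmAlpha_eq_mul (lam : ℝ) (t : ℂ) :
    dklmAlpha lam t = (1 - I * (lam + 1) * t) * (1 - I * (lam - 1) * t) := by
  unfold dklmAlpha
  linear_combination (t ^ 2) * I_sq

/-- **The parabola criterion**: if `w = u + iv` lies on or to the right of the parabola
`{(1+is)² : s ∈ ℝ} = {u = 1 - v²/4}`, then `w` is off the branch cut and `Re √w ≥ 1`.
[cite: DKLM2026SixVertexGFF, Part II, proof of Theorem 40 (proof of the Claim, first item)] -/
theorem one_le_csqrt_re_of_parabola {w : ℂ} (hw : 1 - w.im ^ 2 / 4 ≤ w.re) :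
    w ∈ slitPlane ∧ 1 ≤ (csqrt w).re := by
  have hslit : w ∈ slitPlane := by
    rw [mem_slitPlane_iff]
    by_cases him : w.im = 0
    · left; rw [him] at hw; linarith
    · exact Or.inr him
  refine ⟨hslit, ?_⟩
  have hs2 : csqrt w ^ 2 = w := by
    rw [csqrt, one_div, Complex.cpow_ofNat_inv_pow]
  have hp : 0 < (csqrt w).re := csqrt_re_pos hslit
  set p : ℝ := (csqrt w).re with hpdef
  set q : ℝ := (csqrt w).im with hqdef
  have hre : w.re = p ^ 2 - q ^ 2 := by
    rw [← hs2, sq, mul_re]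
    ring
  have him : w.im = 2 * p * q := by
    rw [← hs2, sq, mul_im]
    ring
  rw [hre, him] at hw
  -- `(p² - 1)(1 + q²) ≥ 0`
  have h1 : 0 ≤ (p ^ 2 - 1) * (1 + q ^ 2) := by nlinarith
  have h2 : 0 ≤ p ^ 2 - 1 := nonneg_of_mul_nonneg_left h1 (by positivity)
  nlinarith

/-- **Claim (i)**: for `λ ≥ 1` and `Im t ≥ 0`, `α_λ(t)` is off the branch cut and `Re √α_λ(t) ≥ 1`.
[cite: DKLM2026SixVertexGFF, Part II, proof of Theorem 40, Claim (i)] -/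
theorem one_le_re_csqrt_dklmAlpha {lam : ℝ} (hlam : 1 ≤ lam) {t : ℂ} (ht : 0 ≤ t.im) :
    dklmAlpha lam t ∈ slitPlane ∧ 1 ≤ (csqrt (dklmAlpha lam t)).re := by
  refine one_le_csqrt_re_of_parabola ?_
  rw [dklmAlpha_re, dklmAlpha_im]
  set x := t.re
  set y := t.im
  set Y := lam + (lam ^ 2 - 1) * y with hY
  have hl2 : 0 ≤ lam ^ 2 - 1 := by nlinarith
  have hYl : lam ≤ Y := by rw [hY]; nlinarith
  have hY2 : lam ^ 2 - 1 + 1 ≤ Y ^ 2 := by nlinarith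
  have hx : 0 ≤ x ^ 2 * (Y ^ 2 - (lam ^ 2 - 1)) := mul_nonneg (sq_nonneg x) (by linarith)
  nlinarith [mul_nonneg hl2 (sq_nonneg y), mul_nonneg (by linarith : (0 : ℝ) ≤ lam) ht]

/-- `‖1 - iκt‖² = (1 + κ Im t)² + κ² (Re t)²`. [folklore] -/
theorem norm_sq_one_sub_I_mul (κ : ℝ) (t : ℂ) : ‖1 - I * κ * t‖ ^ 2 = (1 + κ * t.im) ^ 2 + κ ^ 2 * t.re ^ 2 := by
  rw [Complex.sq_norm, Complex.normSq_apply]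
  simp only [sub_re, one_re, mul_re, I_re, ofReal_re, I_im, ofReal_im, mul_im, sub_im, one_im]
  ring

/-- **The prefactor is bounded**: `‖(1-iλt)/√α_λ(t)‖ ≤ λ/(λ-1)` for `λ > 1`, `Im t ≥ 0`
("the factor `(1-iλt)/√α(t)` is also bounded on `ℍ⁺`").
[cite: DKLM2026SixVertexGFF, Part II, proof of Theorem 40, Claim (ii)] -/
theorem norm_div_csqrt_dklmAlpha_le {lam : ℝ} (hlam : 1 < lam) {t : ℂ} (ht : 0 ≤ t.im) :
    ‖(1 - I * lam * t) / csqrt (dklmAlpha lam t)‖ ≤ lam / (lam - 1) := by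
  obtain ⟨hslit, _⟩ := one_le_re_csqrt_dklmAlpha hlam.le ht
  have hs2 : csqrt (dklmAlpha lam t) ^ 2 = dklmAlpha lam t := by
    rw [csqrt, one_div, Complex.cpow_ofNat_inv_pow]
  have hl1 : 0 < lam - 1 := sub_pos.2 hlam
  -- the three squared norms
  have hN : ∀ κ : ℝ, ‖1 - I * κ * t‖ ^ 2 = (1 + κ * t.im) ^ 2 + κ ^ 2 * t.re ^ 2 := fun κ => norm_sq_one_sub_I_mul κ t
  have hNm_pos : 0 < ‖1 - I * (lam - 1 : ℝ) * t‖ ^ 2 := by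
    rw [hN]; nlinarith [mul_nonneg hl1.le ht, sq_nonneg ((lam - 1) * t.re)]
  -- `‖1 - i(λ-1)t‖ ≤ ‖1 - i(λ+1)t‖`
  have hmono : ‖1 - I * (lam - 1 : ℝ) * t‖ ≤ ‖1 - I * (lam + 1 : ℝ) * t‖ := by
    have hsq : ‖1 - I * (lam - 1 : ℝ) * t‖ ^ 2 ≤ ‖1 - I * (lam + 1 : ℝ) * t‖ ^ 2 := by
      rw [hN, hN]
      nlinarith [mul_nonneg hl1.le ht, sq_nonneg t.re, mul_nonneg (by linarith : (0 : ℝ) ≤ lam + 1) ht]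
    nlinarith [hsq, norm_nonneg (1 - I * (lam - 1 : ℝ) * t), norm_nonneg (1 - I * (lam + 1 : ℝ) * t)]
  -- `‖α‖ ≥ ‖1 - i(λ-1)t‖²`
  have hα : ‖1 - I * (lam - 1 : ℝ) * t‖ ^ 2 ≤ ‖dklmAlpha lam t‖ := by
    rw [dklmAlpha_eq_mul, norm_mul, sq]
    push_cast at hmono ⊢
    exact mul_le_mul_of_nonneg_right hmono (norm_nonneg _)
  -- `(λ-1)² ‖1 - iλt‖² ≤ λ² ‖1 - i(λ-1)t‖²`
  have hkey : (lam - 1) ^ 2 * ‖1 - I * lam * t‖ ^ 2 ≤ lam ^ 2 * ‖1 - I * (lam - 1 : ℝ) * t‖ ^ 2 := by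
    rw [hN, hN]
    have h1 : (lam - 1) * (1 + lam * t.im) ≤ lam * (1 + (lam - 1) * t.im) := by nlinarith
    have h2 : 0 ≤ (lam - 1) * (1 + lam * t.im) := by nlinarith [mul_nonneg (by linarith : (0 : ℝ) ≤ lam) ht]
    nlinarith [mul_le_mul h1 h1 h2 (by nlinarith [mul_nonneg hl1.le ht]), sq_nonneg t.re]
  -- conclude with squares
  rw [norm_div]
  rw [div_le_div_iff₀ (norm_pos_iff.2 (csqrt_ne_zero hslit)) hl1]
  have hsq : ‖csqrt (dklmAlpha lam t)‖ ^ 2 = ‖dklmAlpha lam t‖ := by rw [← norm_pow, hs2]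
  have hsq_le : (‖1 - I * lam * t‖ * (lam - 1)) ^ 2 ≤ (lam * ‖csqrt (dklmAlpha lam t)‖) ^ 2 :=
    calc (‖1 - I * lam * t‖ * (lam - 1)) ^ 2 = (lam - 1) ^ 2 * ‖1 - I * lam * t‖ ^ 2 := by ring
      _ ≤ lam ^ 2 * ‖1 - I * (lam - 1 : ℝ) * t‖ ^ 2 := hkey
      _ ≤ lam ^ 2 * ‖dklmAlpha lam t‖ := by gcongr
      _ = (lam * ‖csqrt (dklmAlpha lam t)‖) ^ 2 := by rw [mul_pow, hsq]
  have h1 : 0 ≤ ‖1 - I * lam * t‖ * (lam - 1) := by positivity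
  have h2 : 0 ≤ lam * ‖csqrt (dklmAlpha lam t)‖ := by positivity
  nlinarith [hsq_le, h1, h2]

/-! ## 2. The function `Φ_λ = F_-` and the Claim -/

variable {c C : ℝ} {μ : Measure (ℝ × ℝ)}

/-- **`Φ_λ(t) := (1-iλt)/√α_λ(t) · F(√α_λ(t), 0)`**, the holomorphic extension of
`F_-(t) = F(1-iλt, t)` given by the rotation formula (eq. (F_minus_in_terms_of_alpha)).
[cite: DKLM2026SixVertexGFF, Part II, proof of Theorem 40, eq. (F_minus_in_terms_of_alpha)] -/
def dklmPhiMinus (μ : Measure (ℝ × ℝ)) (lam : ℝ) (t : ℂ) : ℂ :=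
  (1 - I * lam * t) / csqrt (dklmAlpha lam t) * dklmF μ (csqrt (dklmAlpha lam t)) 0

/-- **Claim (ii)**: `|Φ_λ| ≤ λ/(λ-1) · F(1,0)` on the closed upper half-plane
(`|F(√α,0)| ≤ F(Re √α, 0) ≤ F(1,0)` by Lemma 37 (iv) and Claim (i)).
[cite: DKLM2026SixVertexGFF, Part II, proof of Theorem 40, Claim (ii)] -/
theorem norm_dklmPhiMinus_le (h : μ ∈ dklmSpaceM c C) {lam : ℝ} (hlam : 1 < lam) {t : ℂ} (ht : 0 ≤ t.im) :
    ‖dklmPhiMinus μ lam t‖ ≤ lam / (lam - 1) * (dklmF μ (1 : ℝ) 0).re := by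
  obtain ⟨_, hre⟩ := one_le_re_csqrt_dklmAlpha hlam.le ht
  rw [dklmPhiMinus, norm_mul]
  refine mul_le_mul (norm_div_csqrt_dklmAlpha_le hlam ht) ?_ (norm_nonneg _)
    (div_nonneg (by linarith) (by linarith))
  calc ‖dklmF μ (csqrt (dklmAlpha lam t)) 0‖ ≤ (dklmF μ ((csqrt (dklmAlpha lam t)).re : ℂ) 0).re :=
        norm_dklmF_le h _ 0
    _ ≤ (dklmF μ (1 : ℝ) 0).re := dklmF_re_antitone h one_pos hre

/-- `Φ_λ` is holomorphic on a neighbourhood of the closed upper half-plane (Claim (i): `√α` is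
holomorphic off the branch cut and `F(·,0)` on `ℂ₊`, Lemma 37 (iii)).
[cite: DKLM2026SixVertexGFF, Part II, proof of Theorem 40, Claim (i)] -/
theorem differentiableAt_dklmPhiMinus (h : μ ∈ dklmSpaceM c C) {lam : ℝ} (hlam : 1 ≤ lam) {t : ℂ} (ht : 0 ≤ t.im) :
    DifferentiableAt ℂ (dklmPhiMinus μ lam) t := by
  obtain ⟨hslit, hre⟩ := one_le_re_csqrt_dklmAlpha hlam ht
  have hα : DifferentiableAt ℂ (dklmAlpha lam) t := by
    unfold dklmAlpha; fun_prop
  have hsqrt : DifferentiableAt ℂ (fun t => csqrt (dklmAlpha lam t)) t :=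
    (differentiableAt_csqrt hslit).comp t hα
  have hF : DifferentiableAt ℂ (fun w => dklmF μ w 0) (csqrt (dklmAlpha lam t)) :=
    (differentiableOn_dklmF h 0).differentiableAt
      ((isOpen_lt continuous_const Complex.continuous_re).mem_nhds (show (0 : ℝ) < _ by linarith))
  have hcomp : DifferentiableAt ℂ ((fun w => dklmF μ w 0) ∘ fun t => csqrt (dklmAlpha lam t)) t :=
    DifferentiableAt.comp (g := fun w => dklmF μ w 0) (f := fun t => csqrt (dklmAlpha lam t)) t hF hsqrt
  unfold dklmPhiMinus
  exact (((differentiableAt_const _).sub ((differentiableAt_const _).mul differentiableAt_id)).div hsqrt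
    (csqrt_ne_zero hslit)).mul hcomp

/-- **`Φ_λ = F_-` on the real axis**: `Φ_λ(t) = F(1-iλt, t)` for real `t`, by the rotation formula
(Lemma 43) at `x = 1 - iλt ∈ ℂ₊`, `y = t`.
[cite: DKLM2026SixVertexGFF, Part II, proof of Theorem 40, eq. (F_pm), and Lemma 43] -/
theorem dklmPhiMinus_ofReal (h : μ ∈ dklmSpaceM c C)
    (hrot : ∀ x y : ℝ, 0 < x →
      dklmF μ x y = ((x / Real.sqrt (x ^ 2 + y ^ 2) : ℝ) : ℂ) * dklmF μ (Real.sqrt (x ^ 2 + y ^ 2) : ℝ) 0)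
    (lam t : ℝ) : dklmPhiMinus μ lam t = dklmF μ (1 - I * lam * t) t := by
  have hx : 0 < (1 - I * lam * t : ℂ).re := by simp
  rw [dklmF_rotation h t (fun x hx => hrot x t hx) hx, dklmPhiMinus, dklmAlpha]

/-! ## 3. Theorem 40 -/

/-- **`μ{0 < a, λa < b} = 0` for every `λ > 1`**: the characteristic function `F_-` of
`ρ_λ = (a e^{-a}μ) ∘ (λa - b)⁻¹` extends to the bounded holomorphic function `Φ_λ` on `ℍ⁺`, so
`ρ_λ((-∞,0)) = 0` (one-sided Paley–Wiener), and `a e^{-a} > 0` on `{a > 0}`.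
[cite: DKLM2026SixVertexGFF, Part II, proof of Theorem 40, eq. (targetequationcutoff)] -/
theorem measure_gt_mul_eq_zero (h : μ ∈ dklmSpaceM c C)
    (hrot : ∀ x y : ℝ, 0 < x →
      dklmF μ x y = ((x / Real.sqrt (x ^ 2 + y ^ 2) : ℝ) : ℂ) * dklmF μ (Real.sqrt (x ^ 2 + y ^ 2) : ℝ) 0)
    {lam : ℝ} (hlam : 1 < lam) : μ {p : ℝ × ℝ | 0 < p.1 ∧ lam * p.1 < p.2} = 0 := by
  haveI := isFiniteMeasure_tiltMeasure h one_pos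
  set ρ : Measure ℝ := (tiltMeasure μ 1).map fun p : ℝ × ℝ => lam * p.1 - p.2 with hρ
  have hmeas : Measurable fun p : ℝ × ℝ => lam * p.1 - p.2 := (measurable_fst.const_mul lam).sub measurable_snd
  haveI : IsFiniteMeasure ρ := Measure.isFiniteMeasure_map _ _
  -- one-sided Paley–Wiener for `ρ` with `Φ = Φ_λ`
  have hρ0 : ρ (Iio 0) = 0 := by
    refine measure_Iio_eq_zero_of_charFun_eq_of_continuousAt (Φ := dklmPhiMinus μ lam)
      (B := lam / (lam - 1) * (dklmF μ (1 : ℝ) 0).re) (fun z hz => differentiableAt_dklmPhiMinus h hlam.le hz.le)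
      (fun z hz => norm_dklmPhiMinus_le h hlam hz.le)
      (fun x => (differentiableAt_dklmPhiMinus h hlam.le (by simp)).continuousAt) fun t => ?_
    rw [hρ, charFun_map_linear_tiltMeasure h lam t, dklmPhiMinus_ofReal h hrot lam t]
  -- pull back to `μ`
  have hS : tiltMeasure μ 1 {p : ℝ × ℝ | lam * p.1 - p.2 < 0} = 0 := by
    have : ρ (Iio 0) = tiltMeasure μ 1 ((fun p : ℝ × ℝ => lam * p.1 - p.2) ⁻¹' Iio 0) := by
      rw [hρ, Measure.map_apply hmeas measurableSet_Iio]
    rw [hρ0] at this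
    exact this.symm
  have := measure_inter_pos_eq_zero_of_tiltMeasure hS
  refine measure_mono_null (fun p hp => ?_) this
  have hp' : 0 < p.1 ∧ lam * p.1 < p.2 := hp
  exact ⟨hp'.1, show lam * p.1 - p.2 < 0 by linarith [hp'.2]⟩

/-- **`μ{0 < a, λa < -b} = 0` for every `λ > 1`**, by the reflection symmetry `(a,b) ↦ (a,-b)` of
`μ ∈ 𝓜` (Definition 29). [cite: DKLM2026SixVertexGFF, Part II, proof of Theorem 40] -/
theorem measure_gt_mul_neg_eq_zero (h : μ ∈ dklmSpaceM c C)
    (hrot : ∀ x y : ℝ, 0 < x →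
      dklmF μ x y = ((x / Real.sqrt (x ^ 2 + y ^ 2) : ℝ) : ℂ) * dklmF μ (Real.sqrt (x ^ 2 + y ^ 2) : ℝ) 0)
    {lam : ℝ} (hlam : 1 < lam) : μ {p : ℝ × ℝ | 0 < p.1 ∧ lam * p.1 < -p.2} = 0 := by
  have hR : Measurable (fun p : ℝ × ℝ => (p.1, -p.2)) := measurable_fst.prodMk measurable_snd.neg
  have hSm : MeasurableSet {p : ℝ × ℝ | 0 < p.1 ∧ lam * p.1 < p.2} :=
    (measurableSet_lt measurable_const measurable_fst).inter
      (measurableSet_lt (measurable_fst.const_mul lam) measurable_snd)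
  have hpre : (fun p : ℝ × ℝ => (p.1, -p.2)) ⁻¹' {p : ℝ × ℝ | 0 < p.1 ∧ lam * p.1 < p.2} =
      {p : ℝ × ℝ | 0 < p.1 ∧ lam * p.1 < -p.2} := by
    ext p; simp
  rw [← hpre, ← Measure.map_apply hR hSm, dklmSpaceM_map_reflect h]
  exact measure_gt_mul_eq_zero h hrot hlam

/-- **Theorem 40 (concentration below the diagonal): `μ{|b| > a} = 0`** for every `μ ∈ 𝓜_{c,C}`
whose function `F` satisfies the rotation formula `F(x,y) = x/√(x²+y²) F(√(x²+y²),0)` (`x > 0`),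
i.e. eq. (F_as_derivative_of_I) of Lemma 38 (iii) — the consequence of the rotational invariance
of Theorem 4 along convergence sequences.
[cite: DKLM2026SixVertexGFF, Part II, Theorem 40] -/
theorem dklm_upperBoundOnB (h : μ ∈ dklmSpaceM c C)
    (hrot : ∀ x y : ℝ, 0 < x →
      dklmF μ x y = ((x / Real.sqrt (x ^ 2 + y ^ 2) : ℝ) : ℂ) * dklmF μ (Real.sqrt (x ^ 2 + y ^ 2) : ℝ) 0) :
    μ {p : ℝ × ℝ | p.1 < |p.2|} = 0 := by
  -- `λ_n = 1 + 1/(n+1)`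
  set lamn : ℕ → ℝ := fun n => 1 + 1 / ((n : ℝ) + 1) with hlamn
  have hlamn_gt : ∀ n, 1 < lamn n := fun n => by rw [hlamn]; simp; positivity
  have hcover : {p : ℝ × ℝ | p.1 < |p.2|} ⊆ {p : ℝ × ℝ | p.1 ≤ 0} ∪
      ⋃ n : ℕ, ({p : ℝ × ℝ | 0 < p.1 ∧ lamn n * p.1 < p.2} ∪ {p : ℝ × ℝ | 0 < p.1 ∧ lamn n * p.1 < -p.2}) := by
    intro p hp
    simp only [mem_setOf_eq] at hp
    by_cases ha : p.1 ≤ 0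
    · exact Or.inl ha
    · push Not at ha
      right
      -- choose `n` with `1/(n+1) < (|b| - a)/a`
      obtain ⟨n, hn⟩ := exists_nat_one_div_lt (div_pos (sub_pos.2 hp) ha)
      refine mem_iUnion.2 ⟨n, ?_⟩
      have hlt : lamn n * p.1 < |p.2| := by
        rw [hlamn]
        simp only
        rw [lt_div_iff₀ ha] at hn
        linarith
      rcases le_or_gt 0 p.2 with hb | hb
      · left; exact ⟨ha, by rwa [abs_of_nonneg hb] at hlt⟩
      · right; exact ⟨ha, by rwa [abs_of_neg hb] at hlt⟩
  refine measure_mono_null hcover (measure_union_null (dklmSpaceM_nonpos_null h) (measure_iUnion_null fun n => ?_))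
  exact measure_union_null (measure_gt_mul_eq_zero h hrot (hlamn_gt n)) (measure_gt_mul_neg_eq_zero h hrot (hlamn_gt n))

/-- **Theorem 40, complementary form**: `|b| ≤ a` for `μ`-a.e. `(a,b)`.
[cite: DKLM2026SixVertexGFF, Part II, Theorem 40] -/
theorem dklm_ae_abs_le (h : μ ∈ dklmSpaceM c C)
    (hrot : ∀ x y : ℝ, 0 < x →
      dklmF μ x y = ((x / Real.sqrt (x ^ 2 + y ^ 2) : ℝ) : ℂ) * dklmF μ (Real.sqrt (x ^ 2 + y ^ 2) : ℝ) 0) :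
    ∀ᵐ p ∂μ, |p.2| ≤ p.1 := by
  rw [ae_iff]
  simpa only [not_le] using dklm_upperBoundOnB h hrot

end Literature.Probability.LatticeModels.SixVertex

end
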